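import Summits.CriticalPhenomena.PercolationContinuityZ3.Theorems.PercNearOneGluingNoHeavyLowerTailSahiThreeCopyTwoPointCertsK5Table

/-!
# Sahi's three-function conjecture — `k = 5` certificate checks, entries 3213–3709

COMPUTATIONAL (`native_decide`, integer arithmetic): the flow-form / face-form certificates of `certTable5` (`…TwoPointCertsK5Table`,
data `…TwoPointCertsK5Data*`) pass `checkEntry5` for the entries 3213 ≤ j < 3710 (chunks of 60).  Seat `prim-sahi-p1`, generation 61;
`--supports stmt-CriticalPhenomena-4575`. [this work]
-/

namespace Summit.CriticalPhenomena.PercolationContinuityZ3.Theorems.SahiThreeCopy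

/-- ★★ The certificates of `certTable5` pass the exact check — entries 3213–3272 (by evaluation). [this work] -/
theorem checkChunk5_3213 : checkChunk5 certTable5 upList5 (upSetsC 4) arrTab5 3213 60 = true := by
  native_decide

/-- ★★ The certificates of `certTable5` pass the exact check — entries 3273–3332 (by evaluation). [this work] -/
theorem checkChunk5_3273 : checkChunk5 certTable5 upList5 (upSetsC 4) arrTab5 3273 60 = true := by
  native_decide

/-- ★★ The certificates of `certTable5` pass the exact check — entries 3333–3358 (by evaluation). [this work] -/
theorem checkChunk5_3333 : checkChunk5 certTable5 upList5 (upSetsC 4) arrTab5 3333 26 = true := by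
  native_decide

/-- ★★ The certificates of `certTable5` pass the exact check — entries 3360–3419 (by evaluation). [this work] -/
theorem checkChunk5_3360 : checkChunk5 certTable5 upList5 (upSetsC 4) arrTab5 3360 60 = true := by
  native_decide

/-- ★★ The certificates of `certTable5` pass the exact check — entries 3420–3479 (by evaluation). [this work] -/
theorem checkChunk5_3420 : checkChunk5 certTable5 upList5 (upSetsC 4) arrTab5 3420 60 = true := by
  native_decide

/-- ★★ The certificates of `certTable5` pass the exact check — entries 3480–3539 (by evaluation). [this work] -/
theorem checkChunk5_3480 : checkChunk5 certTable5 upList5 (upSetsC 4) arrTab5 3480 60 = true := by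
  native_decide

/-- ★★ The certificates of `certTable5` pass the exact check — entries 3540–3599 (by evaluation). [this work] -/
theorem checkChunk5_3540 : checkChunk5 certTable5 upList5 (upSetsC 4) arrTab5 3540 60 = true := by
  native_decide

/-- ★★ The certificates of `certTable5` pass the exact check — entries 3600–3659 (by evaluation). [this work] -/
theorem checkChunk5_3600 : checkChunk5 certTable5 upList5 (upSetsC 4) arrTab5 3600 60 = true := by
  native_decide

/-- ★★ The certificates of `certTable5` pass the exact check — entries 3660–3709 (by evaluation). [this work] -/
theorem checkChunk5_3660 : checkChunk5 certTable5 upList5 (upSetsC 4) arrTab5 3660 50 = true := by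
  native_decide


end Summit.CriticalPhenomena.PercolationContinuityZ3.Theorems.SahiThreeCopy
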